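import Literature.MathematicalPhysics.QuantumFieldTheory.U1WeakCouplingD4Proofs
import HarnessLib

/-!
# Weak-coupling `U(1)₄`: positivity and `β`-monotonicity of the free Wilson-loop expectations
(Ginibre), and the single-`β` form of the Fröhlich–Spencer perimeter law

Second proof companion of `Literature/MathematicalPhysics/QuantumFieldTheory/U1WeakCouplingD4.lean`
(named fact `FrohlichSpencerU1PerimeterLawD4`: Fröhlich–Spencer 1982 (2.6)–(2.8), p. 419, proved
in print for the Villain action, §2.10 (2.88); Garban–Sepúlveda 2023 Thm 1.2 with Prop. 2.11),
continuing `U1WeakCouplingD4Proofs.lean` (existence of the free-boundary infinite-volume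
Wilson-loop expectations `E_β[W_γ] = lim_n ⟨W_γ⟩_{Λ_n,β}` by Ginibre monotonicity in the volume,
and the reduction of the fact to finite-volume bounds at each large `β`). Everything here is
PROVED; no definition and no named fact is introduced (D-0026). Contents:

* `integral_reChar_nonneg`, `ginibreExpect_reChar_nonneg` — **Griffiths' first inequality** for
  the Ginibre models of `GinibreModel.lean`: `⟨Re χ₀⟩_J ≥ 0` for non-negative couplings (Ginibre
  1970 Prop. 3 / Example 4: monotonicity from `J = 0`, where the expectation is the Haar
  integral of the real part of a character, which is `1` or `0`);
* `zdExpect_u1_wilsonLoop_box_nonneg` — hence `⟨W_γ⟩_{Λ_n,β} ≥ 0` for `β ≥ 0`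
  (Garban–Sepúlveda 2023 p. 20: "Ginibre's inequalities … imply that for all loops `γ`,
  `E_β[W_γ] ≥ 0`"), and `zdExpect_u1_wilsonLoop_box_mono_beta` — **Griffiths' second
  inequality in `β`**: `⟨W_γ⟩_{Λ_n,β} ≤ ⟨W_γ⟩_{Λ_n,β'}` for `0 ≤ β ≤ β'`;
* for the limits: `u1_boxLimit_ge_zdExpect` (the limit dominates every cube expectation of a
  cube containing the loop), `u1_boxLimit_nonneg`, `u1_boxLimit_le_one`, `u1_boxLimit_mono_beta`
  (`E_β[W_γ]` is non-decreasing in `β ≥ 0`);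
* `frohlichSpencerU1PerimeterLawD4_of_single_beta` — **the single-`β` reduction**: if at ONE
  `β₀ ≥ 0` there is `c > 0` such that every rectangular loop `γ` (`i ≠ j`, `R, T ≥ 1`) satisfies
  the finite-volume free-boundary bound `e^{-c|γ|} ≤ ⟨W_γ⟩_{Λ_n,β₀}` for infinitely many `n`,
  then `FrohlichSpencerU1PerimeterLawD4` holds with threshold `β₀` and the SAME constant `c` for
  every `β > β₀` (the perimeter constant may be taken non-increasing in `β`); and the converse
  direction `single_beta_of_frohlichSpencerU1PerimeterLawD4` (with constant `c + 1`), so that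
  `frohlichSpencerU1PerimeterLawD4_iff_single_beta` records the remaining proof obligation of
  the fact in its weakest finite-volume form.

## References

* J. Ginibre, *General formulation of Griffiths' inequalities*, Comm. Math. Phys. 16 (1970)
  310–328, Prop. 3 with Example 4.
* J. Fröhlich, T. Spencer, Comm. Math. Phys. 83 (1982) 411–454, (2.6)–(2.8) p. 419, (2.88) p. 432.
* C. Garban, A. Sepúlveda, IMRN 2023 (arXiv:2107.04021), Thm 1.2, Prop. 2.11, p. 20.
-/

noncomputable section

open MeasureTheory Filter Finset
open scoped Topology
open Literature.Probability.LatticeModels Literature.MathematicalPhysics.QuantumLattice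

namespace Literature.MathematicalPhysics.QuantumFieldTheory

open AreaLaw

/-! ### Haar integrals of characters; Griffiths' first inequality for Ginibre models -/

section Haar

variable {Ω : Type*} [CommGroup Ω] [TopologicalSpace Ω] [IsTopologicalGroup Ω] [CompactSpace Ω]
  [MeasurableSpace Ω] [BorelSpace Ω]

/-- The Haar integral of the real part of a continuous unitary character of a compact abelian
group is non-negative (it is `1` for the trivial character and `0` otherwise, by invariance
`∫ χ(ψθ) dθ = ∫ χ(θ) dθ = χ(ψ) ∫ χ(θ) dθ`). [folklore] -/
theorem integral_reChar_nonneg (μ : Measure Ω) [μ.IsHaarMeasure] [IsFiniteMeasure μ]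
    (χ₀ : Ω →ₜ* Circle) : 0 ≤ ∫ θ, reChar χ₀ θ ∂μ := by
  by_cases htriv : ∀ ψ : Ω, χ₀ ψ = 1
  · exact integral_nonneg fun θ => by simp [reChar, htriv θ]
  push Not at htriv
  obtain ⟨ψ, hψ⟩ := htriv
  -- the complex integral `c = ∫ χ₀` satisfies `c = χ₀(ψ) c`, hence vanishes
  set f : Ω → ℂ := fun θ => ((χ₀ θ : Circle) : ℂ) with hf
  have hfc : Continuous f := continuous_subtype_val.comp χ₀.continuous
  have hfi : Integrable f μ := hfc.integrable_of_hasCompactSupport (HasCompactSupport.of_compactSpace f)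
  have hinv : ∫ θ, f (ψ * θ) ∂μ = ∫ θ, f θ ∂μ := integral_mul_left_eq_self f ψ
  have hmul : ∫ θ, f (ψ * θ) ∂μ = ((χ₀ ψ : Circle) : ℂ) * ∫ θ, f θ ∂μ := by
    rw [← integral_const_mul]
    refine integral_congr_ae (ae_of_all _ fun θ => ?_)
    simp [hf, map_mul]
  have hc0 : ∫ θ, f θ ∂μ = 0 := by
    have h1 : (((χ₀ ψ : Circle) : ℂ) - 1) * ∫ θ, f θ ∂μ = 0 := by
      rw [sub_mul, one_mul, ← hmul, hinv, sub_self]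
    rcases mul_eq_zero.1 h1 with h | h
    · exact absurd (Circle.ext (by simpa [sub_eq_zero] using h)) hψ
    · exact h
  have hre : ∫ θ, reChar χ₀ θ ∂μ = (∫ θ, f θ ∂μ).re := by
    have h := integral_re hfi
    simpa [hf, reChar] using h
  rw [hre, hc0, Complex.zero_re]

variable [SecondCountableTopology Ω] {ι : Type*} [Fintype ι]

/-- **Griffiths' first inequality for Ginibre models**: `⟨Re χ₀⟩_J ≥ 0` for non-negative
couplings `J` (monotonicity in the couplings from `J = 0`, where the expectation is the Haar
integral of `Re χ₀`, which is `≥ 0`). [cite: Ginibre1970, Prop. 3 with Example 4] -/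
theorem ginibreExpect_reChar_nonneg (μ : Measure Ω) [μ.IsHaarMeasure] [IsProbabilityMeasure μ]
    (h2 : Function.Surjective fun ψ : Ω => ψ * ψ) (χ : ι → Ω →ₜ* Circle) (χ₀ : Ω →ₜ* Circle)
    {J : ι → ℝ} (hJ : ∀ a, 0 ≤ J a) : 0 ≤ ginibreExpect μ χ J (reChar χ₀) := by
  have h0 : ginibreExpect μ χ (fun _ => 0) (reChar χ₀) = ∫ θ, reChar χ₀ θ ∂μ := by
    have hw : ∀ θ, ginibreWeight χ (fun _ => (0 : ℝ)) θ = 1 := fun θ => by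
      simp [ginibreWeight, ginibreHamiltonian]
    simp [ginibreExpect, hw]
  calc (0 : ℝ) ≤ ginibreExpect μ χ (fun _ => 0) (reChar χ₀) := by
        rw [h0]; exact integral_reChar_nonneg μ χ₀
    _ ≤ ginibreExpect μ χ J (reChar χ₀) :=
        ginibreExpect_reChar_mono μ h2 χ χ₀ (fun _ => le_rfl) hJ

end Haar

/-! ### Positivity and `β`-monotonicity of the free cube expectations -/

section Ginibre

/-- The switched-off couplings are non-decreasing in `β`. [folklore] -/
theorem boxCoupling_mono_beta {β β' : ℝ} (h : β ≤ β') (n L : ℕ) (q : Plaquette 4 (L + 1)) :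
    boxCoupling β n L q ≤ boxCoupling β' n L q := by
  unfold boxCoupling
  split_ifs
  · exact h
  · exact le_rfl

/-- **Positivity (Griffiths I / Ginibre).** For Wilson-action `U(1)₄` at `β ≥ 0` and a
rectangular loop contained in the cube `Λ_n` (base point in `{-m,…,m}⁴`, `R + m ≤ n`,
`T + m ≤ n`, `i ≠ j`): `0 ≤ ⟨W_γ⟩_{Λ_n,β}` (Garban–Sepúlveda 2023 p. 20: "Ginibre's inequalities …
imply that for all loops `γ`, `E_β[W_γ] ≥ 0`"). [cite: Ginibre1970, Prop. 3 with Example 4] -/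
theorem zdExpect_u1_wilsonLoop_box_nonneg {β : ℝ} (hβ : 0 ≤ β) {m : ℕ}
    {x : Literature.Probability.LatticeModels.Site 4} (hx : x ∈ box 4 m) {i j : Fin 4} (hij : i ≠ j)
    {R T n : ℕ} (hR : R + m ≤ n) (hT : T + m ≤ n) :
    0 ≤ zdExpect u1Rep β (box 4 n) (zdWilsonLoop u1Rep x i j R T) := by
  rw [zdExpect_u1_box_eq_ginibreExpect_of_mem_box le_rfl hx hij hR hT]
  exact ginibreExpect_reChar_nonneg _ (fun θ => exists_mul_self_eq_u1Config θ) _ _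
    (fun q => boxCoupling_nonneg hβ n _ q)

/-- **Monotonicity in `β` (Griffiths II / Ginibre).** For Wilson-action `U(1)₄`, `0 ≤ β ≤ β'`,
and a rectangular loop contained in the cube `Λ_n` (hypotheses as above):
`⟨W_γ⟩_{Λ_n,β} ≤ ⟨W_γ⟩_{Λ_n,β'}` — both are the same torus Ginibre model with couplings
`boxCoupling β n ≤ boxCoupling β' n`. [cite: Ginibre1970, Prop. 3 with Example 4] -/
theorem zdExpect_u1_wilsonLoop_box_mono_beta {β β' : ℝ} (hβ : 0 ≤ β) (hββ' : β ≤ β') {m : ℕ}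
    {x : Literature.Probability.LatticeModels.Site 4} (hx : x ∈ box 4 m) {i j : Fin 4} (hij : i ≠ j)
    {R T n : ℕ} (hR : R + m ≤ n) (hT : T + m ≤ n) :
    zdExpect u1Rep β (box 4 n) (zdWilsonLoop u1Rep x i j R T) ≤
      zdExpect u1Rep β' (box 4 n) (zdWilsonLoop u1Rep x i j R T) := by
  rw [zdExpect_u1_box_eq_ginibreExpect_of_mem_box (β := β) le_rfl hx hij hR hT,
    zdExpect_u1_box_eq_ginibreExpect_of_mem_box (β := β') le_rfl hx hij hR hT]
  exact ginibreExpect_reChar_mono _ (fun θ => exists_mul_self_eq_u1Config θ) _ _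
    (fun q => boxCoupling_nonneg hβ n _ q) (fun q => boxCoupling_mono_beta hββ' n _ q)

end Ginibre

/-! ### Consequences for the infinite-volume free expectations -/

section Limit

/-- **The limit dominates the cube expectations.** If `⟨W_γ⟩_{Λ_n,β} → w` (`β ≥ 0`) then
`⟨W_γ⟩_{Λ_n,β} ≤ w` for every cube `Λ_n` containing the loop (base point in `{-m,…,m}⁴`,
`R + m ≤ n`, `T + m ≤ n`, `i ≠ j`): from such an `n` on the expectations are non-decreasing
(`zdExpect_u1_wilsonLoop_box_mono`). [folklore] -/
theorem u1_boxLimit_ge_zdExpect {β : ℝ} (hβ : 0 ≤ β) {m : ℕ}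
    {x : Literature.Probability.LatticeModels.Site 4} (hx : x ∈ box 4 m) {i j : Fin 4} (hij : i ≠ j)
    {R T n : ℕ} (hR : R + m ≤ n) (hT : T + m ≤ n) {w : ℝ}
    (hw : HasBoxLimit (fun Λ => zdExpect u1Rep β Λ (zdWilsonLoop u1Rep x i j R T)) w) :
    zdExpect u1Rep β (box 4 n) (zdWilsonLoop u1Rep x i j R T) ≤ w := by
  have hmono : Monotone fun k : ℕ =>
      zdExpect u1Rep β (box 4 (k + n)) (zdWilsonLoop u1Rep x i j R T) := by
    intro k k' hkk'
    exact zdExpect_u1_wilsonLoop_box_mono hβ hx hij (by omega) (by omega) (by omega)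
  have ht : Tendsto (fun k : ℕ => zdExpect u1Rep β (box 4 (k + n)) (zdWilsonLoop u1Rep x i j R T))
      atTop (𝓝 w) :=
    (tendsto_add_atTop_iff_nat (f := fun k : ℕ =>
      zdExpect u1Rep β (box 4 k) (zdWilsonLoop u1Rep x i j R T)) n).2 hw
  simpa using hmono.ge_of_tendsto ht 0

/-- The infinite-volume free Wilson-loop expectation is `≥ 0` (`β ≥ 0`, `i ≠ j`). [cite: Ginibre1970, Prop. 3 with Example 4] -/
theorem u1_boxLimit_nonneg {β : ℝ} (hβ : 0 ≤ β) {x : Literature.Probability.LatticeModels.Site 4}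
    {i j : Fin 4} (hij : i ≠ j) {R T : ℕ} {w : ℝ}
    (hw : HasBoxLimit (fun Λ => zdExpect u1Rep β Λ (zdWilsonLoop u1Rep x i j R T)) w) :
    0 ≤ w := by
  have hx : x ∈ box 4 (Site.supNorm x) := mem_box_iff_supNorm_le.2 le_rfl
  exact (zdExpect_u1_wilsonLoop_box_nonneg hβ hx hij (n := R + T + Site.supNorm x)
    (by omega) (by omega)).trans (u1_boxLimit_ge_zdExpect hβ hx hij (by omega) (by omega) hw)

/-- The infinite-volume free Wilson-loop expectation is `≤ 1`. [folklore] -/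
theorem u1_boxLimit_le_one {β : ℝ} {x : Literature.Probability.LatticeModels.Site 4}
    {i j : Fin 4} {R T : ℕ} {w : ℝ}
    (hw : HasBoxLimit (fun Λ => zdExpect u1Rep β Λ (zdWilsonLoop u1Rep x i j R T)) w) :
    w ≤ 1 :=
  le_of_tendsto' hw fun _ => zdExpect_u1_wilsonLoop_le_one β _ x i j R T

/-- **The infinite-volume free Wilson-loop expectation is non-decreasing in `β ≥ 0`**: if
`⟨W_γ⟩_{Λ_n,β} → w` and `⟨W_γ⟩_{Λ_n,β'} → w'` with `0 ≤ β ≤ β'` (`i ≠ j`) then `w ≤ w'`.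
[cite: Ginibre1970, Prop. 3 with Example 4] -/
theorem u1_boxLimit_mono_beta {β β' : ℝ} (hβ : 0 ≤ β) (hββ' : β ≤ β')
    {x : Literature.Probability.LatticeModels.Site 4} {i j : Fin 4} (hij : i ≠ j) {R T : ℕ}
    {w w' : ℝ}
    (hw : HasBoxLimit (fun Λ => zdExpect u1Rep β Λ (zdWilsonLoop u1Rep x i j R T)) w)
    (hw' : HasBoxLimit (fun Λ => zdExpect u1Rep β' Λ (zdWilsonLoop u1Rep x i j R T)) w') :
    w ≤ w' := by
  have hx : x ∈ box 4 (Site.supNorm x) := mem_box_iff_supNorm_le.2 le_rfl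
  refine le_of_tendsto_of_tendsto hw hw' ?_
  filter_upwards [eventually_ge_atTop (R + T + Site.supNorm x)] with n hn
  exact zdExpect_u1_wilsonLoop_box_mono_beta hβ hββ' hx hij (by omega) (by omega)

end Limit

/-! ### The single-`β` form of the Fröhlich–Spencer perimeter law -/

section SingleBeta

/-- **It suffices to bound the finite-volume expectations at a single `β₀`.** If at one
`β₀ ≥ 0` there is `c > 0` such that for every rectangular loop `γ` (`i ≠ j`, `R, T ≥ 1`) the
free cube expectations satisfy `e^{-c·2(R+T)} ≤ ⟨W_γ⟩_{Λ_n,β₀}` for infinitely many `n`, then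
`FrohlichSpencerU1PerimeterLawD4` holds with threshold `β₀` and the same constant `c` for every
`β > β₀`: the cube expectations at `β₀` are dominated by their limit, and the limits are
non-decreasing in `β` (Ginibre). [folklore] -/
theorem frohlichSpencerU1PerimeterLawD4_of_single_beta
    (h : ∃ β₀ : ℝ, 0 ≤ β₀ ∧ ∃ c : ℝ, 0 < c ∧
      ∀ (x : Literature.Probability.LatticeModels.Site 4) (i j : Fin 4) (R T : ℕ),
        i ≠ j → 1 ≤ R → 1 ≤ T →
          ∃ᶠ n : ℕ in atTop, Real.exp (-c * (2 * (R + T))) ≤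
            zdExpect u1Rep β₀ (box 4 n) (zdWilsonLoop u1Rep x i j R T)) :
    FrohlichSpencerU1PerimeterLawD4 := by
  obtain ⟨β₀, hβ₀, c, hc, hb⟩ := h
  refine ⟨β₀, fun β hβ => ⟨c, hc, fun x i j R T hij hR hT => ?_⟩⟩
  have hx : x ∈ box 4 (Site.supNorm x) := mem_box_iff_supNorm_le.2 le_rfl
  obtain ⟨w₀, hw₀, -, -⟩ := hasBoxLimit_zdExpect_u1_wilsonLoop hβ₀ x hij R T
  obtain ⟨w, hw, -, -⟩ := hasBoxLimit_zdExpect_u1_wilsonLoop (hβ₀.trans hβ.le) x hij R T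
  obtain ⟨n, hnb, hn⟩ := ((hb x i j R T hij hR hT).and_eventually
    (eventually_ge_atTop (R + T + Site.supNorm x))).exists
  exact ⟨w, hw, (hnb.trans (u1_boxLimit_ge_zdExpect hβ₀ hx hij (by omega) (by omega) hw₀)).trans
    (u1_boxLimit_mono_beta hβ₀ hβ.le hij hw₀ hw)⟩

/-- Conversely, `FrohlichSpencerU1PerimeterLawD4` yields the single-`β` finite-volume bounds at
`β₀ = max β₁ 0 + 1` with constant `c(β₀) + 1`: the cube expectations converge to the limit
`w ≥ e^{-c|γ|} > e^{-(c+1)|γ|}`, so they exceed `e^{-(c+1)|γ|}` for all large `n`. [folklore] -/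
theorem single_beta_of_frohlichSpencerU1PerimeterLawD4 (h : FrohlichSpencerU1PerimeterLawD4) :
    ∃ β₀ : ℝ, 0 ≤ β₀ ∧ ∃ c : ℝ, 0 < c ∧
      ∀ (x : Literature.Probability.LatticeModels.Site 4) (i j : Fin 4) (R T : ℕ),
        i ≠ j → 1 ≤ R → 1 ≤ T →
          ∃ᶠ n : ℕ in atTop, Real.exp (-c * (2 * (R + T))) ≤
            zdExpect u1Rep β₀ (box 4 n) (zdWilsonLoop u1Rep x i j R T) := by
  obtain ⟨β₁, hβ₁⟩ := h
  obtain ⟨c, hc, hw⟩ := hβ₁ (max β₁ 0 + 1) (by linarith [le_max_left β₁ 0])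
  refine ⟨max β₁ 0 + 1, by linarith [le_max_right β₁ 0], c + 1, by linarith,
    fun x i j R T hij hR hT => ?_⟩
  obtain ⟨w, hlim, hwc⟩ := hw x i j R T hij hR hT
  have hR' : (1 : ℝ) ≤ R := by exact_mod_cast hR
  have hT' : (1 : ℝ) ≤ T := by exact_mod_cast hT
  have hlt : Real.exp (-(c + 1) * (2 * ((R : ℝ) + T))) < w :=
    lt_of_lt_of_le (Real.exp_lt_exp.2 (by nlinarith)) hwc
  exact (Filter.Tendsto.eventually_const_lt hlt hlim).frequently.mono fun n hn => hn.le

/-- **The remaining proof obligation of `FrohlichSpencerU1PerimeterLawD4` in its weakest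
finite-volume form**: the fact is EQUIVALENT to the existence of one `β₀ ≥ 0` and one `c > 0`
such that every rectangular loop obeys the free-boundary finite-volume perimeter bound
`e^{-c·2(R+T)} ≤ ⟨W_{R×T}(x)⟩_{Λ_n,β₀}` for infinitely many cubes `Λ_n` (Guth's theorem at a
single coupling, uniformly in the loop; Fröhlich–Spencer 1982 (2.88) prove such bounds for all
cubes, for the Villain action). [folklore] -/
theorem frohlichSpencerU1PerimeterLawD4_iff_single_beta :
    FrohlichSpencerU1PerimeterLawD4 ↔
      ∃ β₀ : ℝ, 0 ≤ β₀ ∧ ∃ c : ℝ, 0 < c ∧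
        ∀ (x : Literature.Probability.LatticeModels.Site 4) (i j : Fin 4) (R T : ℕ),
          i ≠ j → 1 ≤ R → 1 ≤ T →
            ∃ᶠ n : ℕ in atTop, Real.exp (-c * (2 * (R + T))) ≤
              zdExpect u1Rep β₀ (box 4 n) (zdWilsonLoop u1Rep x i j R T) :=
  ⟨single_beta_of_frohlichSpencerU1PerimeterLawD4, frohlichSpencerU1PerimeterLawD4_of_single_beta⟩

end SingleBeta

end Literature.MathematicalPhysics.QuantumFieldTheory
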